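/-
Origin: expansion seat `planner-pub-hodgecm-pv05-g5-0`, handover #7 2026-08-18T09:30:34Z (`HOME/pub-hodgecm-pv05-g5/lean/Pv05g5/FockBargmann.lean`, md5 15fdbb92, 191 lines);
landed by the gen-7 packager in gate run 27 as `HodgeCM/PerL34/FockBargmann.lean` (import ^import Pv05g5\.→import HodgeCM.PerL34. ×1).
-/
/-
Copyright (c) 2026. Released under the Apache 2.0 license (see the HodgeCMPerL package LICENSE).
HodgeCM/PerL34/FockBargmann.lean — pub-hodgecm DAG node `FockBargmann`, part (B) (seat pv05, gen 5).

# The Bargmann transform as a unitary `L²(ℝ^σ) ≃ FockL2 σ` — Folland §1.6/§1.7, kernel-proved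

Source followed VERBATIM: G. B. Folland, *Harmonic Analysis in Phase Space*, Annals of Math. Studies 122,
Princeton UP 1989 [Fo89], Ch. 1 §6–§7; held text `book:folland1989-harmonic-analysis-phase-space`.

[Fo89 chunk p0038 L14–L20, (1.64)ff]: `B` is a unitary map `L²(ℝⁿ) → 𝓕_n`; [chunk p0045 L45]: "We call `B⁻¹ζ_α`
the αth (normalized, n-dimensional) Hermite function and denote it by `h_α`"; [chunk p0045 L49]:
"`Z_j = π^{−1/2} B⁻¹ A_j B`, `Z_j^* = π^{−1/2} B⁻¹ A_j^* B`" with [(1.74)] `A_j = π^{−1/2} ∂/∂z_j`, `A_j^* = π^{1/2} z_j`;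
[(1.78)/(1.81)]: `B⁻¹ F = F(Z^*) h_0` for polynomials `F`, `h_α = √(π^{|α|}/α!) (Z^*)^α h_0`.

What is KERNEL here (ZERO cited facts):
* `bargmann : Lp ℂ 2 (volume : Measure (σ → ℝ)) ≃ₗᵢ[ℂ] FockL2 σ` — a GENUINE UNITARY between GENUINE Hilbert
  spaces: `L²(ℝ^σ, dx)` and the Fock space `FockL2 σ ⊂ L²(ℂ^σ, dz)` of `FockSpaceL2`; it is THE unitary matching
  the two kernel-proved Hilbert bases, `hermiteBasis` ([Fo89 §1.7 (vii)], `FockHermiteComplete`) and `fockBasis`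
  ([Fo89 (1.63)], `FockSpaceL2`): `bargmann_hermiteL2 α : B h_α = ζ_α e^{−(π/2)|z|²}`, `bargmann_symm_fockVec`;
* the POLYNOMIAL-CORE DICTIONARY as theorems about this unitary: with `hermToL2 p = p(x)e^{−π|x|²} ∈ L²(ℝ^σ)` and
  `fockToL2 F = F(z)e^{−(π/2)|z|²} ∈ FockL2 σ` (linear in `p`, `F`),
  `bargmann_hermToL2_binv F : B (F(Z^*)h_0) = F` and `bargmann_symm_fockToL2 F : B⁻¹ F = F(Z^*) h_0` ((1.78),
  `binv` of `FockHermite`), `bargmann_opZs : B Z_j^* B⁻¹ = z_j·` and `bargmann_opZ : B Z_j B⁻¹ = π⁻¹ ∂/∂z_j` on the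
  core (p0045 L49 with (1.74)), from the symbol identities `binv_X_mul` / `opZ_binv` of `FockHermite`;
* density of both cores: `hermToL2_denseRange`, `fockToL2_denseRange`.

Declared PRINT residual (NOT claimed in this file): the identification of `bargmann` with Folland's INTEGRAL
transform `Bf(z) = 2^{n/4} ∫ f(x) e^{2πx·z − πx² − (π/2)z²} dx` [chunk p0037 L13] on all of `L²(ℝⁿ)` (part (C) of
the node, in progress), and the range statement `FockL2 σ = e^{−(π/2)|z|²}𝓕_n` (see `FockSpaceL2`).

Policy: imports `HodgeCM.PerL34.FockSpaceL2` only; no placeholders, no new axioms; additive leaf (namespace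
`HodgeCM.PerL34.Fock.Hermite`).
-/
import Summits.HodgeConjecture.HodgeCM.PerL34.FockSpaceL2

set_option autoImplicit false

open MvPolynomial Complex MeasureTheory
open scoped Real InnerProductSpace

namespace HodgeCM.PerL34.Fock.Hermite

noncomputable section

variable {σ : Type*} [Fintype σ] [DecidableEq σ]

/-! ### The Bargmann transform as a unitary `L²(ℝ^σ) ≃ FockL2 σ` -/

/-- **The Bargmann transform** ([Fo89 §1.6 (1.63)–(1.64), §1.7 p0045: "We call `B⁻¹ζ_α` the αth Hermite function
`h_α`"]): the unitary `L²(ℝ^σ, dx) ≃ FockL2 σ` carrying the Hermite Hilbert basis `h_α` to the Fock Hilbert basis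
`ζ_α e^{−(π/2)|z|²}`. -/
def bargmann : Lp ℂ 2 (volume : Measure (σ → ℝ)) ≃ₗᵢ[ℂ] FockL2 σ :=
  hermiteBasis.repr.trans fockBasis.repr.symm

/-- `B h_α = ζ_α`. -/
theorem bargmann_hermiteL2 (α : σ →₀ ℕ) : bargmann (hermiteL2 α) = fockVec α := by
  rw [bargmann, LinearIsometryEquiv.trans_apply, ← hermiteBasis_apply, hermiteBasis.repr_self,
    fockBasis.repr_symm_single, fockBasis_apply]

/-- `B⁻¹ ζ_α = h_α` ([Fo89 p0045 L45]). -/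
theorem bargmann_symm_fockVec (α : σ →₀ ℕ) : bargmann.symm (fockVec α) = hermiteL2 α := by
  rw [← bargmann_hermiteL2, LinearIsometryEquiv.symm_apply_apply]

/-! ### The polynomial cores on both sides -/

omit [DecidableEq σ] in
/-- `p ↦ p(x) e^{−π|x|²}` as a linear map `ℂ[x_σ] → L²(ℝ^σ)`. -/
def hermToL2 : MvPolynomial σ ℂ →ₗ[ℂ] Lp ℂ 2 (volume : Measure (σ → ℝ)) where
  toFun p := (memLp_hermiteFun p).toLp _
  map_add' p q := by
    have hfg : hermiteFun (p + q) =ᵐ[volume] hermiteFun p + hermiteFun q :=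
      Filter.Eventually.of_forall fun x => hermiteFun_add p q x
    rw [MemLp.toLp_congr (memLp_hermiteFun (p + q)) ((memLp_hermiteFun p).add (memLp_hermiteFun q)) hfg]
    rfl
  map_smul' c p := by
    have hfg : hermiteFun (c • p) =ᵐ[volume] c • hermiteFun p :=
      Filter.Eventually.of_forall fun x => by rw [hermiteFun_smul, Pi.smul_apply, smul_eq_mul]
    rw [MemLp.toLp_congr (memLp_hermiteFun (c • p)) ((memLp_hermiteFun p).const_smul c) hfg]
    rfl

omit [DecidableEq σ] in
/-- (Ported verbatim from the HodgeCMPerL package; no docstring in the source.) -/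
theorem hermToL2_apply (p : MvPolynomial σ ℂ) : hermToL2 p = (memLp_hermiteFun p).toLp _ := rfl

omit [DecidableEq σ] in
/-- (Ported verbatim from the HodgeCMPerL package; no docstring in the source.) -/
theorem hermToL2_coeFn (p : MvPolynomial σ ℂ) : ⇑(hermToL2 p) =ᵐ[volume] hermiteFun p :=
  MemLp.coeFn_toLp (memLp_hermiteFun p)

/-- (Ported verbatim from the HodgeCMPerL package; no docstring in the source.) -/
@[simp] theorem hermToL2_herm (α : σ →₀ ℕ) : hermToL2 (herm α) = hermiteL2 α := rfl

omit [DecidableEq σ] in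
/-- `F ↦ F(z) e^{−(π/2)|z|²}` as a linear map `ℂ[z_σ] → L²(ℂ^σ)`. -/
def fockToLp : MvPolynomial σ ℂ →ₗ[ℂ] Lp ℂ 2 (volume : Measure (σ → ℂ)) where
  toFun F := (memLp_fockFun F).toLp _
  map_add' F G := by
    have hfg : fockFun (F + G) =ᵐ[volume] fockFun F + fockFun G :=
      Filter.Eventually.of_forall fun z => fockFun_add F G z
    rw [MemLp.toLp_congr (memLp_fockFun (F + G)) ((memLp_fockFun F).add (memLp_fockFun G)) hfg]
    rfl
  map_smul' c F := by
    have hfg : fockFun (c • F) =ᵐ[volume] c • fockFun F :=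
      Filter.Eventually.of_forall fun z => by rw [fockFun_smul, Pi.smul_apply, smul_eq_mul]
    rw [MemLp.toLp_congr (memLp_fockFun (c • F)) ((memLp_fockFun F).const_smul c) hfg]
    rfl

omit [DecidableEq σ] in
/-- (Ported verbatim from the HodgeCMPerL package; no docstring in the source.) -/
theorem fockToLp_apply (F : MvPolynomial σ ℂ) : fockToLp F = (memLp_fockFun F).toLp _ := rfl

omit [DecidableEq σ] in
/-- (Ported verbatim from the HodgeCMPerL package; no docstring in the source.) -/
@[simp] theorem fockToLp_zeta (α : σ →₀ ℕ) : fockToLp (zeta α) = zetaL2 α := rfl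

omit [DecidableEq σ] in
/-- (Ported verbatim from the HodgeCMPerL package; no docstring in the source.) -/
theorem monomial_one_eq_smul_zeta (β : σ →₀ ℕ) : (monomial β (1 : ℂ) : MvPolynomial σ ℂ) = ((hcoef β : ℂ)⁻¹) • zeta β := by
  rw [zeta, smul_smul, inv_mul_cancel₀ (Complex.ofReal_ne_zero.mpr (hcoef_pos β).ne'), one_smul]

omit [DecidableEq σ] in
/-- Polynomials `F e^{−(π/2)|z|²}` lie in the Fock space. -/
theorem fockToLp_mem (F : MvPolynomial σ ℂ) : fockToLp F ∈ FockL2 σ := by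
  refine Submodule.le_topologicalClosure _ ?_
  induction F using MvPolynomial.induction_on' with
  | monomial β c =>
      rw [show (monomial β c : MvPolynomial σ ℂ) = c • monomial β 1 by rw [smul_monomial, smul_eq_mul, mul_one],
        monomial_one_eq_smul_zeta, map_smul, map_smul, fockToLp_zeta]
      exact Submodule.smul_mem _ _ (Submodule.smul_mem _ _ (Submodule.subset_span (Set.mem_range_self β)))
  | add p q hp hq => rw [map_add]; exact Submodule.add_mem _ hp hq

omit [DecidableEq σ] in
/-- `F ↦ F(z) e^{−(π/2)|z|²}` as a linear map `ℂ[z_σ] → FockL2 σ`. -/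
def fockToL2 : MvPolynomial σ ℂ →ₗ[ℂ] FockL2 σ := LinearMap.codRestrict (FockL2 σ) fockToLp fockToLp_mem

omit [DecidableEq σ] in
/-- (Ported verbatim from the HodgeCMPerL package; no docstring in the source.) -/
@[simp] theorem coe_fockToL2 (F : MvPolynomial σ ℂ) : ((fockToL2 F : FockL2 σ) : Lp ℂ 2 (volume : Measure (σ → ℂ))) = fockToLp F := rfl

omit [DecidableEq σ] in
/-- (Ported verbatim from the HodgeCMPerL package; no docstring in the source.) -/
theorem fockToL2_coeFn (F : MvPolynomial σ ℂ) :
    ⇑((fockToL2 F : FockL2 σ) : Lp ℂ 2 (volume : Measure (σ → ℂ))) =ᵐ[volume] fockFun F :=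
  MemLp.coeFn_toLp (memLp_fockFun F)

omit [DecidableEq σ] in
/-- (Ported verbatim from the HodgeCMPerL package; no docstring in the source.) -/
@[simp] theorem fockToL2_zeta (α : σ →₀ ℕ) : fockToL2 (zeta α) = fockVec α := rfl

/-! ### The dictionary, as theorems about the unitary `bargmann` -/

/-- **`B (F(Z^*) h_0) = F`** on the polynomial core ([Fo89 (1.64)/(1.78) with (1.81)]): for every polynomial `F`,
the Bargmann transform of `(binv F)(x) e^{−π|x|²} = F(Z^*)h_0` is `F(z) e^{−(π/2)|z|²}`. -/
theorem bargmann_hermToL2_binv (F : MvPolynomial σ ℂ) : bargmann (hermToL2 (binv F)) = fockToL2 F := by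
  induction F using MvPolynomial.induction_on' with
  | monomial β c =>
      rw [show (monomial β c : MvPolynomial σ ℂ) = c • monomial β 1 by rw [smul_monomial, smul_eq_mul, mul_one],
        monomial_one_eq_smul_zeta, map_smul, map_smul, map_smul, map_smul, map_smul, map_smul, map_smul, map_smul]
      rw [← herm, hermToL2_herm, bargmann_hermiteL2, fockToL2_zeta]
  | add p q hp hq => rw [map_add, map_add, map_add, map_add, hp, hq]

/-- **`B⁻¹ F = F(Z^*) h_0`** ([Fo89 (1.78)]). -/
theorem bargmann_symm_fockToL2 (F : MvPolynomial σ ℂ) : bargmann.symm (fockToL2 F) = hermToL2 (binv F) := by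
  rw [← bargmann_hermToL2_binv, LinearIsometryEquiv.symm_apply_apply]

/-- **`B Z_j^* B⁻¹ = (multiplication by z_j)`** on the polynomial core ([Fo89 p0045 L49: `Z_j^* = π^{−1/2} B⁻¹ A_j^* B`,
`A_j^* = π^{1/2} z_j`]). -/
theorem bargmann_opZs (j : σ) (F : MvPolynomial σ ℂ) :
    bargmann (hermToL2 (opZs j (binv F))) = fockToL2 (X j * F) := by
  rw [← binv_X_mul, bargmann_hermToL2_binv]

/-- **`B Z_j B⁻¹ = π⁻¹ ∂/∂z_j`** on the polynomial core ([Fo89 p0045 L49: `Z_j = π^{−1/2} B⁻¹ A_j B`,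
`A_j = π^{−1/2} ∂/∂z_j`]). -/
theorem bargmann_opZ (j : σ) (F : MvPolynomial σ ℂ) :
    bargmann (hermToL2 (opZ j (binv F))) = (π : ℂ)⁻¹ • fockToL2 (pderiv j F) := by
  rw [opZ_binv, map_smul, map_smul, bargmann_hermToL2_binv]

/-! ### Density of the two polynomial cores -/

/-- The finite linear combinations of Hermite functions — equivalently (by `binv_surjective`) all `p(x)e^{−π|x|²}`,
`p` a polynomial — are dense in `L²(ℝ^σ)`. -/
theorem hermToL2_denseRange : (LinearMap.range (hermToL2 (σ := σ))).topologicalClosure = ⊤ := by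
  have h := (hermiteBasis (σ := σ)).dense_span
  refine eq_top_iff.mpr (h.ge.trans (Submodule.topologicalClosure_mono ?_))
  rw [Submodule.span_le]
  rintro _ ⟨α, rfl⟩
  exact ⟨herm α, by rw [hermiteBasis_apply]; rfl⟩

omit [DecidableEq σ] in
/-- The polynomials `F(z) e^{−(π/2)|z|²}` are dense in the Fock space. -/
theorem fockToL2_denseRange : (LinearMap.range (fockToL2 (σ := σ))).topologicalClosure = ⊤ := by
  have h := (fockBasis (σ := σ)).dense_span
  refine eq_top_iff.mpr (h.ge.trans (Submodule.topologicalClosure_mono ?_))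
  rw [Submodule.span_le]
  rintro _ ⟨α, rfl⟩
  exact ⟨zeta α, by rw [fockBasis_apply]; rfl⟩

end

end HodgeCM.PerL34.Fock.Hermite
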